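import Mathlib
import HarnessLib
import Literature.Probability.Percolation.Percolation
import Literature.Probability.Percolation.ConditionalPositiveAssociation
import Literature.Probability.Percolation.ConditionalPositiveAssociationProofs

/-!
# `NoHeavyLowerTail` (crux stmt-CriticalPhenomena-4575), antithetic vdBHK programme: the explicit RAA relation is a preorder reversed by the
# complement (graph level)

Support file (seat `prim-ineq-gen-7` gen 44; `--supports stmt-CriticalPhenomena-4575`).  No `sorry`, no definitions.
Memo: run/shared/lean/prim/prim-ineq-gen-7/FINDING-MULTISINK-g44.md §0′.

By `Antithetic.raaLE_iff_explicit` (…AntitheticRAAExplicit, p396446) the RAA order of FINDING-RAA-g20 on the 2-colourings `s ⊆ E` (red set) of a loop-free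
edge set with sink set `T` is the EXPLICIT relation
  `R(s, s′) :⟺ λ(s′) ⊆ λ(s) ∧ λ̄(s) ⊆ λ̄(s′) ∧ ∀ e ∈ s \\ s′, e ∈ λ(s) ∩ λ̄(s′)`,  `λ(s) = ⋃_{t∈T} C_t(s)`, `λ̄(s) = ⋃_{t∈T} C_t(E \\ s)`.
This file records, directly from the explicit form, the three structural facts that make `(𝒫(E), R, s ↦ E \\ s)` a poset-with-antitone-involution —
the object about which CONJECTURE RAA ('antipodal Kleitman') is stated:
* `Antithetic.raaExplicit_refl` — `R` is reflexive;   * `Antithetic.raaExplicit_trans` — `R` is transitive;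
* `Antithetic.raaExplicit_compl` — `R(s, s′) → R(E \\ s′, E \\ s)` for `s, s′ ⊆ E` (the complement reverses the order);
* `Antithetic.raaExplicit_sinkEdge_lift` — flipping a red NON-LOOP edge at a sink to blue goes UP: `R(s, s \\ {e})` for `e = s(t,w) ∈ s`, `t ∈ T`
  (the lift `b < θ b` of PROOF-RL-g43 and of every sink-edge slicing, FINDING-MULTISINK-g44 §4c).
-/

namespace Summit.CriticalPhenomena.PercolationContinuityZ3.Theorems

namespace Antithetic

open Literature.Probability.Percolation

variable {V : Type*}

/-- The explicit RAA relation is reflexive. [this work] -/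
theorem raaExplicit_refl (T : Set V) (E s : Set (Sym2 V)) :
    (∀ e, (∃ t ∈ T, e ∈ openEdgeCluster s t) → (∃ t ∈ T, e ∈ openEdgeCluster s t)) ∧
    (∀ e, (∃ t ∈ T, e ∈ openEdgeCluster (E \ s) t) → (∃ t ∈ T, e ∈ openEdgeCluster (E \ s) t)) ∧
    (∀ e ∈ s \ s, (∃ t ∈ T, e ∈ openEdgeCluster s t) ∧ (∃ t ∈ T, e ∈ openEdgeCluster (E \ s) t)) := by
  refine ⟨fun _ h => h, fun _ h => h, ?_⟩
  intro e he
  simp at he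

/-- The explicit RAA relation is transitive. [this work] -/
theorem raaExplicit_trans (T : Set V) (E s₁ s₂ s₃ : Set (Sym2 V))
    (h₁₂ : (∀ e, (∃ t ∈ T, e ∈ openEdgeCluster s₂ t) → (∃ t ∈ T, e ∈ openEdgeCluster s₁ t)) ∧
      (∀ e, (∃ t ∈ T, e ∈ openEdgeCluster (E \ s₁) t) → (∃ t ∈ T, e ∈ openEdgeCluster (E \ s₂) t)) ∧
      (∀ e ∈ s₁ \ s₂, (∃ t ∈ T, e ∈ openEdgeCluster s₁ t) ∧ (∃ t ∈ T, e ∈ openEdgeCluster (E \ s₂) t)))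
    (h₂₃ : (∀ e, (∃ t ∈ T, e ∈ openEdgeCluster s₃ t) → (∃ t ∈ T, e ∈ openEdgeCluster s₂ t)) ∧
      (∀ e, (∃ t ∈ T, e ∈ openEdgeCluster (E \ s₂) t) → (∃ t ∈ T, e ∈ openEdgeCluster (E \ s₃) t)) ∧
      (∀ e ∈ s₂ \ s₃, (∃ t ∈ T, e ∈ openEdgeCluster s₂ t) ∧ (∃ t ∈ T, e ∈ openEdgeCluster (E \ s₃) t))) :
    (∀ e, (∃ t ∈ T, e ∈ openEdgeCluster s₃ t) → (∃ t ∈ T, e ∈ openEdgeCluster s₁ t)) ∧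
      (∀ e, (∃ t ∈ T, e ∈ openEdgeCluster (E \ s₁) t) → (∃ t ∈ T, e ∈ openEdgeCluster (E \ s₃) t)) ∧
      (∀ e ∈ s₁ \ s₃, (∃ t ∈ T, e ∈ openEdgeCluster s₁ t) ∧ (∃ t ∈ T, e ∈ openEdgeCluster (E \ s₃) t)) := by
  obtain ⟨a1, a2, a3⟩ := h₁₂
  obtain ⟨b1, b2, b3⟩ := h₂₃
  refine ⟨fun e h => a1 e (b1 e h), fun e h => b2 e (a2 e h), ?_⟩
  rintro e ⟨he1, he3⟩
  by_cases he2 : e ∈ s₂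
  · obtain ⟨c1, c2⟩ := b3 e ⟨he2, he3⟩
    exact ⟨a1 e c1, c2⟩
  · obtain ⟨c1, c2⟩ := a3 e ⟨he1, he2⟩
    exact ⟨c1, b2 e c2⟩

/-- The complement `s ↦ E \\ s` reverses the explicit RAA relation (for `s, s′ ⊆ E`). [this work] -/
theorem raaExplicit_compl (T : Set V) (E s s' : Set (Sym2 V)) (hs : s ⊆ E) (hs' : s' ⊆ E)
    (h : (∀ e, (∃ t ∈ T, e ∈ openEdgeCluster s' t) → (∃ t ∈ T, e ∈ openEdgeCluster s t)) ∧
      (∀ e, (∃ t ∈ T, e ∈ openEdgeCluster (E \ s) t) → (∃ t ∈ T, e ∈ openEdgeCluster (E \ s') t)) ∧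
      (∀ e ∈ s \ s', (∃ t ∈ T, e ∈ openEdgeCluster s t) ∧ (∃ t ∈ T, e ∈ openEdgeCluster (E \ s') t))) :
    (∀ e, (∃ t ∈ T, e ∈ openEdgeCluster (E \ s) t) → (∃ t ∈ T, e ∈ openEdgeCluster (E \ s') t)) ∧
      (∀ e, (∃ t ∈ T, e ∈ openEdgeCluster (E \ (E \ s')) t) → (∃ t ∈ T, e ∈ openEdgeCluster (E \ (E \ s)) t)) ∧
      (∀ e ∈ (E \ s') \ (E \ s), (∃ t ∈ T, e ∈ openEdgeCluster (E \ s') t) ∧ (∃ t ∈ T, e ∈ openEdgeCluster (E \ (E \ s)) t)) := by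
  obtain ⟨h1, h2, h3⟩ := h
  have e1 : E \ (E \ s) = s := Set.sdiff_sdiff_cancel_left hs
  have e2 : E \ (E \ s') = s' := Set.sdiff_sdiff_cancel_left hs'
  rw [e1, e2]
  refine ⟨h2, h1, ?_⟩
  rintro e ⟨⟨heE, hes'⟩, hn⟩
  have hes : e ∈ s := by by_contra hes; exact hn ⟨heE, hes⟩
  obtain ⟨c1, c2⟩ := h3 e ⟨hes, hes'⟩
  exact ⟨c2, c1⟩

/-- **Sink-edge lift.**  Flipping a red non-loop edge `e = s(t,w)` at a sink `t ∈ T` to blue goes UP in the explicit RAA relation: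
`R(s, s \\ {e})`. [this work] -/
theorem raaExplicit_sinkEdge_lift (T : Set V) (E s : Set (Sym2 V)) (hs : s ⊆ E) (t w : V) (ht : t ∈ T) (htw : t ≠ w)
    (he : s(t, w) ∈ s) :
    (∀ e, (∃ t' ∈ T, e ∈ openEdgeCluster (s \ {s(t, w)}) t') → (∃ t' ∈ T, e ∈ openEdgeCluster s t')) ∧
      (∀ e, (∃ t' ∈ T, e ∈ openEdgeCluster (E \ s) t') → (∃ t' ∈ T, e ∈ openEdgeCluster (E \ (s \ {s(t, w)})) t')) ∧
      (∀ e ∈ s \ (s \ {s(t, w)}), (∃ t' ∈ T, e ∈ openEdgeCluster s t') ∧ (∃ t' ∈ T, e ∈ openEdgeCluster (E \ (s \ {s(t, w)})) t')) := by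
  have sub1 : s \ {s(t, w)} ⊆ s := Set.sdiff_subset
  have sub2 : E \ s ⊆ E \ (s \ {s(t, w)}) := Set.sdiff_subset_sdiff_right sub1
  refine ⟨?_, ?_, ?_⟩
  · rintro e ⟨t', ht', h⟩; exact ⟨t', ht', BHK2006.openEdgeCluster_mono sub1 t' h⟩
  · rintro e ⟨t', ht', h⟩; exact ⟨t', ht', BHK2006.openEdgeCluster_mono sub2 t' h⟩
  · rintro e ⟨hes, hen⟩
    have hee : e = s(t, w) := by
      by_contra hne; exact hen ⟨hes, hne⟩
    subst hee
    -- an open non-loop edge at the sink t lies in the cluster of t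
    have key : ∀ (ω : Set (Sym2 V)), s(t, w) ∈ ω → s(t, w) ∈ openEdgeCluster ω t := by
      intro ω hω
      rw [mem_openEdgeCluster_iff]
      refine ⟨hω, by rw [Sym2.mk_isDiag_iff]; exact htw, ?_⟩
      intro z hz
      rcases Sym2.mem_iff.1 hz with hz | hz
      · rw [hz]
      · rw [hz]; exact SimpleGraph.Adj.reachable ((openGraph_adj ω t w).2 ⟨hω, htw⟩)
    constructor
    · exact ⟨t, ht, key s he⟩
    · refine ⟨t, ht, key _ ⟨hs he, ?_⟩⟩
      rintro ⟨-, hne⟩; exact hne rfl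

end Antithetic

end Summit.CriticalPhenomena.PercolationContinuityZ3.Theorems
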